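import Mathlib

/-!
# Crux `ArithStatLadder.IqThreeNotPPoly` (stmt-QuantumAdvantage-2422)

Stub `stub_sqfreeProductNagell` of the line `Sketch` (skeleton v4, "Nagell planting"): the
algebraic glue of the YES-density argument (Mathlib only).

With `t = 1 + 11 G + 11 G² + 30 G j` the sampler outputs `d = G t · (G t + 8) · (4 G t + 27)`.
For `G` odd and prime to `3` the four factors `G`, `t`, `G t + 8`, `4 G t + 27` are PAIRWISE
COPRIME, so `d` is squarefree as soon as each factor is (`Nat.squarefree_mul_iff`).

The coprimalities are elementary congruences:
* `gcd(G, t) = 1` since `t = 1 + G · (11 + 11 G + 30 j) ≡ 1 (mod G)`;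
* `t` is odd and `3 ∤ t` (in `ZMod 2`, resp. `ZMod 3`, the polynomial `1 + 11 x + 11 x² + 30 x y`
  never vanishes, by `decide`), hence `G t` is odd and prime to `3`, which gives
  `gcd(G t, G t + 8) = gcd(G t, 8) = 1` and `gcd(G t, 4 G t + 27) = gcd(G t, 27) = 1`;
* `gcd(G t + 8, 4 G t + 27)` divides `4 (G t + 8) - (4 G t + 27) = 5`, and `5 ∤ G t + 8`
  (in `ZMod 5`, `x (1 + 11 x + 11 x² + 30 x y) + 8` never vanishes, by `decide`).
-/

set_option linter.dupNamespace false -- D-0017: single-problem summit ⇒ QuantumAdvantage.QuantumAdvantage by design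

namespace Summit.QuantumAdvantage.QuantumAdvantage.Theorems.IqThreeNotPPoly

/-- Mod `2`: the polynomial `1 + 11 x + 11 x² + 30 x y` never vanishes on `ZMod 2`. -/
theorem sqfreeProductNagell_key_two :
    ∀ x y : ZMod 2, 1 + 11 * x + 11 * x ^ 2 + 30 * x * y ≠ 0 := by
  decide

/-- Mod `3`: the polynomial `1 + 11 x + 11 x² + 30 x y` never vanishes on `ZMod 3`. -/
theorem sqfreeProductNagell_key_three :
    ∀ x y : ZMod 3, 1 + 11 * x + 11 * x ^ 2 + 30 * x * y ≠ 0 := by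
  decide

/-- Mod `5`: the polynomial `x (1 + 11 x + 11 x² + 30 x y) + 8` never vanishes on `ZMod 5`. -/
theorem sqfreeProductNagell_key_five :
    ∀ x y : ZMod 5, x * (1 + 11 * x + 11 * x ^ 2 + 30 * x * y) + 8 ≠ 0 := by
  decide

/-- `t = 1 + 11 G + 11 G² + 30 G j` is odd. -/
theorem sqfreeProductNagell_not_two_dvd (G j : ℕ) :
    ¬ 2 ∣ 1 + 11 * G + 11 * G ^ 2 + 30 * G * j := by
  intro h
  have h0 : ((1 + 11 * G + 11 * G ^ 2 + 30 * G * j : ℕ) : ZMod 2) = 0 :=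
    (ZMod.natCast_eq_zero_iff _ _).2 h
  exact sqfreeProductNagell_key_two (G : ZMod 2) (j : ZMod 2) (by exact_mod_cast h0)

/-- `t = 1 + 11 G + 11 G² + 30 G j` is prime to `3`. -/
theorem sqfreeProductNagell_not_three_dvd (G j : ℕ) :
    ¬ 3 ∣ 1 + 11 * G + 11 * G ^ 2 + 30 * G * j := by
  intro h
  have h0 : ((1 + 11 * G + 11 * G ^ 2 + 30 * G * j : ℕ) : ZMod 3) = 0 :=
    (ZMod.natCast_eq_zero_iff _ _).2 h
  exact sqfreeProductNagell_key_three (G : ZMod 3) (j : ZMod 3) (by exact_mod_cast h0)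

/-- `G t + 8` is prime to `5`. -/
theorem sqfreeProductNagell_not_five_dvd (G j : ℕ) :
    ¬ 5 ∣ G * (1 + 11 * G + 11 * G ^ 2 + 30 * G * j) + 8 := by
  intro h
  have h0 : ((G * (1 + 11 * G + 11 * G ^ 2 + 30 * G * j) + 8 : ℕ) : ZMod 5) = 0 :=
    (ZMod.natCast_eq_zero_iff _ _).2 h
  exact sqfreeProductNagell_key_five (G : ZMod 5) (j : ZMod 5) (by exact_mod_cast h0)

/-- If `a` is not divisible by the prime `p`, then `a` is coprime to every power of `p`. -/
theorem sqfreeProductNagell_coprime_prime_pow {p a : ℕ} (hp : p.Prime) (ha : ¬ p ∣ a) (n : ℕ) :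
    Nat.Coprime a (p ^ n) :=
  Nat.Coprime.pow_right n ((Nat.Prime.coprime_iff_not_dvd hp).2 ha).symm

/-- **STUB C · `stub_sqfreeProductNagell`**: for `G` squarefree, odd and prime to `3`, the
sampler output `G t (G t + 8) (4 G t + 27)`, `t = 1 + 11 G + 11 G² + 30 G j`, is squarefree as
soon as `t`, `G t + 8` and `4 G t + 27` are (the four factors are pairwise coprime). -/
theorem stub_sqfreeProductNagell :
    ∀ (G j : ℕ), Squarefree G → ¬ 2 ∣ G → ¬ 3 ∣ G →
    Squarefree (1 + 11 * G + 11 * G ^ 2 + 30 * G * j) →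
    Squarefree (G * (1 + 11 * G + 11 * G ^ 2 + 30 * G * j) + 8) →
    Squarefree (4 * (G * (1 + 11 * G + 11 * G ^ 2 + 30 * G * j)) + 27) →
      Squarefree (G * (1 + 11 * G + 11 * G ^ 2 + 30 * G * j) *
        (G * (1 + 11 * G + 11 * G ^ 2 + 30 * G * j) + 8) *
        (4 * (G * (1 + 11 * G + 11 * G ^ 2 + 30 * G * j)) + 27)) := by
  intro G j hG hG2 hG3 ht hB hC
  have ht2 := sqfreeProductNagell_not_two_dvd G j
  have ht3 := sqfreeProductNagell_not_three_dvd G j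
  have hB5 := sqfreeProductNagell_not_five_dvd G j
  set t : ℕ := 1 + 11 * G + 11 * G ^ 2 + 30 * G * j with ht_def
  -- `gcd(G, t) = 1`: `t ≡ 1 (mod G)`.
  have hGt : Nat.Coprime G t := by
    have e : t = 1 + G * (11 + 11 * G + 30 * j) := by rw [ht_def]; ring
    rw [e, Nat.coprime_add_mul_left_right]
    exact Nat.coprime_one_right _
  -- `G t` is odd and prime to `3`.
  have hA2 : ¬ 2 ∣ G * t := by
    rw [Nat.Prime.dvd_mul Nat.prime_two]
    rintro (h | h)
    exacts [hG2 h, ht2 h]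
  have hA3 : ¬ 3 ∣ G * t := by
    rw [Nat.Prime.dvd_mul Nat.prime_three]
    rintro (h | h)
    exacts [hG3 h, ht3 h]
  -- `gcd(G t, G t + 8) = gcd(G t, 8) = 1`.
  have hAB : Nat.Coprime (G * t) (G * t + 8) := by
    rw [Nat.coprime_self_add_right]
    have h8 : (8 : ℕ) = 2 ^ 3 := by norm_num
    rw [h8]
    exact sqfreeProductNagell_coprime_prime_pow Nat.prime_two hA2 3
  -- `gcd(G t, 4 G t + 27) = gcd(G t, 27) = 1`.
  have hAC : Nat.Coprime (G * t) (4 * (G * t) + 27) := by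
    rw [Nat.coprime_mul_right_add_right]
    have h27 : (27 : ℕ) = 3 ^ 3 := by norm_num
    rw [h27]
    exact sqfreeProductNagell_coprime_prime_pow Nat.prime_three hA3 3
  -- `gcd(G t + 8, 4 G t + 27) ∣ 5` and `5 ∤ G t + 8`.
  have hBC : Nat.Coprime (G * t + 8) (4 * (G * t) + 27) := by
    have hd : Nat.gcd (G * t + 8) (4 * (G * t) + 27) ∣ 5 := by
      have h1 : Nat.gcd (G * t + 8) (4 * (G * t) + 27) ∣ 4 * (G * t + 8) :=
        Dvd.dvd.mul_left (Nat.gcd_dvd_left _ _) 4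
      have h2 : Nat.gcd (G * t + 8) (4 * (G * t) + 27) ∣ 4 * (G * t) + 27 :=
        Nat.gcd_dvd_right _ _
      have e : 4 * (G * t + 8) = 4 * (G * t) + 27 + 5 := by ring
      rw [e] at h1
      exact (Nat.dvd_add_right h2).1 h1
    rcases (Nat.dvd_prime Nat.prime_five).1 hd with h | h
    · exact h
    · exact absurd (h ▸ Nat.gcd_dvd_left _ _) hB5
  have hABC : Nat.Coprime (G * t * (G * t + 8)) (4 * (G * t) + 27) :=
    Nat.coprime_mul_iff_left.2 ⟨hAC, hBC⟩
  rw [Nat.squarefree_mul_iff, Nat.squarefree_mul_iff, Nat.squarefree_mul_iff]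
  exact ⟨hABC, ⟨hAB, ⟨hGt, hG, ht⟩, hB⟩, hC⟩

end Summit.QuantumAdvantage.QuantumAdvantage.Theorems.IqThreeNotPPoly
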